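import Summits.PneNP.PneNP.Theorems.OracleRefusal.Negative.StaTableDefs

/-!
# `OracleRefusal` (stmt-PneNP-1864) — negative side, II: Semantic inversion of STA derivations of word codes, part 1 (see `StaTableDefs` for the overview): renaming inversions for
the term shapes of a word (§B.0), junk trees / wrapped leaves / real leaves of slot labels (§B.1), slot descriptions of
valuations and their transport along the administrative rules `(w) (m) (∀I) (⊸I) (⊸E)` (§B.2).
-/

namespace Summit.PneNP.PneNP.Theorems.OracleRefusal.Negative

open Literature.Computability.ImplicitComplexity
open Literature.Computability.ImplicitComplexity.URel
open Literature.Computability.ImplicitComplexity.STA (Deriv Ctx Term LinTy SoftTy encWord encBit tyS tyB tyF mpxRen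
  liftRen)

/-! ## §B.0 Renaming inversions for the term shapes of a word -/

/-- A renaming hits a variable only from a variable. [folklore] -/
theorem rename_eq_var {M : Term} {f : ℕ → ℕ} {i : ℕ} (h : M.rename f = .var i) : ∃ i', M = .var i' ∧ f i' = i := by
  cases M with
  | var i' => exact ⟨i', rfl, by simpa [Term.rename] using h⟩
  | app _ _ => cases h
  | lam _ => cases h
  | sum _ _ => cases h

/-- A renaming hits an abstraction only from an abstraction. [folklore] -/
theorem rename_eq_lam {M N : Term} {f : ℕ → ℕ} (h : M.rename f = .lam N) : ∃ M', M = .lam M' ∧ M'.rename (liftRen f) = N := by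
  cases M with
  | var _ => cases h
  | app _ _ => cases h
  | lam M' => exact ⟨M', rfl, by simpa [Term.rename] using h⟩
  | sum _ _ => cases h

/-- A renaming hits an application only from an application. [folklore] -/
theorem rename_eq_app {M F N : Term} {f : ℕ → ℕ} (h : M.rename f = .app F N) :
    ∃ F' N', M = .app F' N' ∧ F'.rename f = F ∧ N'.rename f = N := by
  cases M with
  | var _ => cases h
  | app F' N' =>
    simp only [Term.rename, Term.app.injEq] at h
    exact ⟨F', N', rfl, h.1, h.2⟩
  | lam _ => cases h
  | sum _ _ => cases h

/-- `liftRen (liftRen f)` takes the value `0` only at `0`. [folklore] -/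
theorem liftRen_liftRen_eq_zero {f : ℕ → ℕ} {i : ℕ} (h : liftRen (liftRen f) i = 0) : i = 0 := by
  rcases i with _ | _ | i
  · rfl
  · simp [liftRen] at h
  · simp [liftRen] at h

/-- `liftRen (liftRen f)` takes the value `1` only at `1`. [folklore] -/
theorem liftRen_liftRen_eq_one {f : ℕ → ℕ} {i : ℕ} (h : liftRen (liftRen f) i = 1) : i = 1 := by
  rcases i with _ | _ | i
  · simp [liftRen] at h
  · rfl
  · simp [liftRen] at h

/-- The letters are closed: a renaming hits `encBit b` only from `encBit b`. [folklore] -/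
theorem rename_eq_encBit {M : Term} {f : ℕ → ℕ} {b : Bool} (h : M.rename f = encBit b) : M = encBit b := by
  have h2 : ∀ {i₀ : ℕ}, (i₀ = 0 ∨ i₀ = 1) → M.rename f = .lam (.lam (.var i₀)) → M = .lam (.lam (.var i₀)) := by
    intro i₀ hi₀ h
    obtain ⟨M₁, rfl, h₁⟩ := rename_eq_lam h
    obtain ⟨M₂, rfl, h₂⟩ := rename_eq_lam h₁
    obtain ⟨i, rfl, hi⟩ := rename_eq_var h₂
    rcases hi₀ with rfl | rfl
    · rw [liftRen_liftRen_eq_zero hi]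
    · rw [liftRen_liftRen_eq_one hi]
  cases b
  · exact h2 (Or.inr rfl) h
  · exact h2 (Or.inl rfl) h

/-! ## §B.1 Junk trees, wrapped leaves, leaf sets -/

/-- JUNK labels of bang-depth `k`: `![]` at depth `0` (a discarded linear hypothesis), boxes of junk above (multiplexors
of dummies, rank-`0` multiplexors). [cite: LaurentTortoraDeFalco2006, Def. 12] -/
def Junk : ℕ → Set Point
  | 0 => {bang0}
  | k + 1 => {x | ∃ M : Multiset Point, (∀ y ∈ M, y ∈ Junk k) ∧ x = Point.ofCourse M}

/-- WRAPPED labels of bang-depth `k` around one real leaf `ℓ`: `ℓ` itself at depth `0`, and above a box containing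
one wrapped label and junk (the slot of a variable used once, multiplexed `k` times together with dummies).
[cite: LaurentTortoraDeFalco2006, Def. 12] -/
def Wrap : ℕ → Point → Set Point
  | 0, ℓ => {ℓ}
  | k + 1, ℓ => {x | ∃ V ∈ Wrap k ℓ, ∃ M : Multiset Point, (∀ y ∈ M, y ∈ Junk k) ∧ x = Point.ofCourse (V ::ₘ M)}

/-- The REAL LEAVES of a label of bang-depth `k`: the contents `a` of the one-copy boxes `![a]` sitting at depth `k`.
[cite: LaurentTortoraDeFalco2006, Def. 12] -/
def leafSet : ℕ → Point → Set Point
  | 0, x => {a | x = bang1 a}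
  | k + 1, x => {a | ∃ (M : Multiset Point) (y : Point), x = Point.ofCourse M ∧ y ∈ M ∧ a ∈ leafSet k y}

/-- `![]` is junk at every depth. [folklore] -/
theorem bang0_mem_junk : ∀ k, bang0 ∈ Junk k
  | 0 => rfl
  | _ + 1 => ⟨0, fun y h => absurd h (Multiset.notMem_zero y), (rfl : bang0 = Point.ofCourse 0)⟩

/-- A box of junk is junk. [folklore] -/
theorem ofCourse_mem_junk {k : ℕ} {M : Multiset Point} (h : ∀ y ∈ M, y ∈ Junk k) : Point.ofCourse M ∈ Junk (k + 1) :=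
  ⟨M, h, rfl⟩

/-- Junk labels belong to every argument clique of the same depth. [folklore] -/
theorem junk_subset_argClique (L : Set Point) : ∀ k, Junk k ⊆ argClique k L
  | 0 => by
      intro x hx
      rw [show x = bang0 from hx]
      exact mem_liftClique.2 (Or.inl rfl)
  | k + 1 => by
      rintro _ ⟨M, hM, rfl⟩
      rw [argClique_succ]
      exact ⟨M, fun y hy => junk_subset_argClique L k (hM y hy), rfl⟩

/-- A label wrapped around `![a]` belongs to every argument clique of the same depth containing `a`. [folklore] -/
theorem wrap_subset_argClique {L : Set Point} {a : Point} (ha : a ∈ L) : ∀ k, Wrap k (bang1 a) ⊆ argClique k L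
  | 0 => by
      intro x hx
      rw [show x = bang1 a from hx]
      exact mem_liftClique.2 (Or.inr ⟨a, ha, rfl⟩)
  | k + 1 => by
      rintro _ ⟨V, hV, M, hM, rfl⟩
      rw [argClique_succ]
      refine ⟨V ::ₘ M, fun y hy => ?_, rfl⟩
      rcases Multiset.mem_cons.1 hy with rfl | hy
      · exact wrap_subset_argClique ha k hV
      · exact junk_subset_argClique L k (hM y hy)

/-- A box over an argument clique is in the next argument clique. [folklore] -/
theorem ofCourse_mem_argClique {L : Set Point} {k : ℕ} {M : Multiset Point} (h : ∀ y ∈ M, y ∈ argClique k L) :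
    Point.ofCourse M ∈ argClique (k + 1) L := by
  rw [argClique_succ]; exact ⟨M, h, rfl⟩

/-- Junk has no real leaves. [folklore] -/
theorem leafSet_eq_empty_of_junk : ∀ {k : ℕ} {x : Point}, x ∈ Junk k → ∀ a, a ∉ leafSet k x
  | 0, x, hx, a, ha => by
      change x = bang0 at hx
      change x = bang1 a at ha
      exact bang1_ne_bang0 a (ha.symm.trans hx)
  | k + 1, _, ⟨M, hM, rfl⟩, a, ⟨M', y, he, hy, ha⟩ => by
      rw [Point.ofCourse_injective he] at hM
      exact leafSet_eq_empty_of_junk (hM y hy) a ha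

/-- The real leaves of a label of an argument clique over `L` lie in `L`. [folklore] -/
theorem leafSet_subset_of_mem_argClique {L : Set Point} : ∀ {k : ℕ} {x : Point}, x ∈ argClique k L → leafSet k x ⊆ L
  | 0, x, hx, a, ha => by
      change x = bang1 a at ha
      subst ha
      rcases mem_liftClique.1 hx with h | ⟨a', ha', h⟩
      · exact absurd h (bang1_ne_bang0 a)
      · rwa [← Multiset.singleton_inj.1 (Point.ofCourse_injective h)]
  | k + 1, x, hx, a, ⟨M, y, hxe, hy, ha⟩ => by
      subst hxe
      rw [argClique_succ] at hx
      obtain ⟨M', hM', he⟩ := hx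
      rw [Point.ofCourse_injective he] at hy
      exact leafSet_subset_of_mem_argClique (hM' y hy) ha

/-- The wrapped leaf is a real leaf. [folklore] -/
theorem mem_leafSet_of_wrap {a : Point} : ∀ {k : ℕ} {x : Point}, x ∈ Wrap k (bang1 a) → a ∈ leafSet k x
  | 0, _, hx => by change _ = _ at hx; exact hx
  | k + 1, _, ⟨V, hV, M, _, rfl⟩ => ⟨V ::ₘ M, V, rfl, Multiset.mem_cons_self _ _, mem_leafSet_of_wrap hV⟩

/-- Real leaves of a box are the real leaves of its elements. [folklore] -/
theorem mem_leafSet_ofCourse {k : ℕ} {M : Multiset Point} {a : Point} :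
    a ∈ leafSet (k + 1) (Point.ofCourse M) ↔ ∃ y ∈ M, a ∈ leafSet k y := by
  constructor
  · rintro ⟨M', y, he, hy, ha⟩
    rw [← Point.ofCourse_injective he] at hy
    exact ⟨y, hy, ha⟩
  · rintro ⟨y, hy, ha⟩
    exact ⟨M, y, rfl, hy, ha⟩

/-! ## §B.2 Slot descriptions of valuations and their transport along the administrative rules -/

/-- Slot `s` of `ρ` carries a label in `T k`, `k` the bang-depth of the slot in `Γ` (vacuous on absent slots).
[cite: LaurentTortoraDeFalco2006, Def. 12] -/
def SlotIn (T : ℕ → Set Point) (Γ : Ctx) (ρ : Val) (s : ℕ) : Prop :=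
  ∀ σ, Γ s = some σ → ∃ V, ρ s = some V ∧ V ∈ T σ.bangs

/-- A family of label sets closed under boxing (junk, argument cliques). [folklore] -/
def Boxable (T : ℕ → Set Point) : Prop := ∀ k (M : Multiset Point), (∀ y ∈ M, y ∈ T k) → Point.ofCourse M ∈ T (k + 1)

/-- Junk is boxable. [folklore] -/
theorem boxable_junk : Boxable Junk := fun _ _ h => ofCourse_mem_junk h

/-- Argument cliques are boxable. [folklore] -/
theorem boxable_argClique (L : Set Point) : Boxable fun k => argClique k L := fun _ _ h => ofCourse_mem_argClique h

namespace SlotIn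

variable {T : ℕ → Set Point} {Γ : Ctx} {ρ : Val} {s : ℕ}

/-- Monotonicity in the family. [folklore] -/
theorem mono {T' : ℕ → Set Point} (hT : ∀ k, T k ⊆ T' k) (h : SlotIn T Γ ρ s) : SlotIn T' Γ ρ s :=
  fun σ hσ => (h σ hσ).imp fun _ hV => ⟨hV.1, hT _ hV.2⟩

/-- `(w)`: the other slots are untouched. [folklore] -/
theorem update_ne {j : ℕ} (hsj : s ≠ j) (τ : Option SoftTy) (v : Option Point) (h : SlotIn T Γ ρ s) :
    SlotIn T (Function.update Γ j τ) (Function.update ρ j v) s := by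
  intro σ hσ
  rw [Function.update_of_ne hsj] at hσ ⊢
  exact h σ hσ

/-- `(w)`: the discarded slot is junk. [folklore] -/
theorem update_self_junk (j : ℕ) (A : LinTy) :
    SlotIn Junk (Function.update Γ j (some ⟨0, A⟩)) (Function.update ρ j (some bang0)) j := by
  intro σ hσ
  rw [Function.update_self] at hσ
  cases hσ
  exact ⟨bang0, Function.update_self .., rfl⟩

/-- `(w)`: the discarded slot carries a label of every family containing `![]` at depth `0`. [folklore] -/
theorem update_self_of_bang0 (hT : bang0 ∈ T 0) (j : ℕ) (A : LinTy) :
    SlotIn T (Function.update Γ j (some ⟨0, A⟩)) (Function.update ρ j (some bang0)) j := by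
  intro σ hσ
  rw [Function.update_self] at hσ
  cases hσ
  exact ⟨bang0, Function.update_self .., hT⟩

/-- `(∀I)`: shifting the type variables of the context changes no bang-depth. [folklore] -/
theorem of_shift (h : SlotIn T Γ.shift ρ s) : SlotIn T Γ ρ s := by
  intro σ hσ
  obtain ⟨V, hV, hm⟩ := h σ.shift (by simp [Ctx.shift, hσ])
  exact ⟨V, hV, hm⟩

/-- `(∀I)`, converse direction. [folklore] -/
theorem shift (h : SlotIn T Γ ρ s) : SlotIn T Γ.shift ρ s := by
  intro σ hσ
  simp only [Ctx.shift, Option.map_eq_some_iff] at hσ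
  obtain ⟨σ', hσ', rfl⟩ := hσ
  obtain ⟨V, hV, hm⟩ := h σ' hσ'
  exact ⟨V, hV, hm⟩

/-- `(⊸I)`: slot `s + 1` under the binder is slot `s` outside. [folklore] -/
theorem unshift {o : Option SoftTy} (h : SlotIn T (Ctx.cons o Γ) ρ (s + 1)) : SlotIn T Γ (Val.unshift ρ) s :=
  fun σ hσ => h σ hσ

/-- `(m)`: slots outside the multiplexor are untouched. [folklore] -/
theorem mpx_of_not_mem {S : Finset ℕ} {j : ℕ} {σ' : SoftTy} (hs : s ∉ S) (hsj : s ≠ j) (h : SlotIn T Γ ρ s) :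
    SlotIn T (Γ.mpx S j σ') (mpxVal S j ρ) s := by
  intro σ hσ
  simp only [Ctx.mpx, hs, if_false, hsj] at hσ
  obtain ⟨V, hV, hm⟩ := h σ hσ
  exact ⟨V, by simp [mpxVal, hs, hsj, hV], hm⟩

/-- `(m)`: contracted slots are absent afterwards. [folklore] -/
theorem mpx_of_mem {S : Finset ℕ} {j : ℕ} {σ' : SoftTy} {ρ' : Val} (hs : s ∈ S) : SlotIn T (Γ.mpx S j σ') ρ' s := by
  intro σ hσ
  simp [Ctx.mpx, hs] at hσ

/-- `(m)`: the fresh slot of a multiplexor whose contracted slots all carry `T`-labels carries a `T`-label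
(boxable `T`). [cite: LaurentTortoraDeFalco2006, Def. 12] -/
theorem mpx_self (hT : Boxable T) {S : Finset ℕ} {j : ℕ} {σ' : SoftTy} (hS : ∀ i ∈ S, Γ i = some σ') (hj : Γ j = none)
    (h : ∀ i ∈ S, SlotIn T Γ ρ i) : SlotIn T (Γ.mpx S j σ') (mpxVal S j ρ) j := by
  have hjS : j ∉ S := fun hj' => by simpa [hj] using hS j hj'
  intro σ hσ
  simp only [Ctx.mpx, hjS, if_false, if_true, Option.some.injEq] at hσ
  subst hσ
  refine ⟨Point.ofCourse (S.val.map ρ.label), by simp [mpxVal, hjS], ?_⟩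
  show Point.ofCourse (S.val.map ρ.label) ∈ T (σ'.bangs + 1)
  refine hT _ _ fun y hy => ?_
  obtain ⟨i, hi, rfl⟩ := Multiset.mem_map.1 hy
  rw [Finset.mem_val] at hi
  obtain ⟨V, hV, hm⟩ := h i hi σ' (hS i hi)
  simpa [Val.label, hV] using hm

/-- `(⊸E)`, function side: a slot of `Γ₁` keeps its description in the merged valuation. [folklore] -/
theorem merge_left {Γ₁ : Ctx} {ρ₁ ρ₂ : Val} (h1 : Γ₁ s = Γ s) (h : SlotIn T Γ₁ ρ₁ s) : SlotIn T Γ (Val.merge ρ₁ ρ₂) s := by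
  intro σ hσ
  obtain ⟨V, hV, hm⟩ := h σ (h1.trans hσ)
  exact ⟨V, by simp [Val.merge, hV], hm⟩

/-- `(⊸E)`, argument side: a slot of `Γ₂` keeps its description in the merged valuation. [folklore] -/
theorem merge_right {Γ₂ : Ctx} {ρ₁ ρ₂ : Val} (h1 : ρ₁ s = none) (h2 : Γ₂ s = Γ s) (h : SlotIn T Γ₂ ρ₂ s) :
    SlotIn T Γ (Val.merge ρ₁ ρ₂) s := by
  intro σ hσ
  obtain ⟨V, hV, hm⟩ := h σ (h2.trans hσ)
  exact ⟨V, by simp [Val.merge, h1, hV], hm⟩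

/-- The discarding valuation is junk on every slot. [cite: LaurentTortoraDeFalco2006, Def. 12] -/
theorem discard (Γ : Ctx) (s : ℕ) : SlotIn Junk Γ (Val.discard Γ) s := by
  intro σ hσ
  exact ⟨bang0, by simp [Val.discard, hσ], bang0_mem_junk _⟩

end SlotIn

end Summit.PneNP.PneNP.Theorems.OracleRefusal.Negative
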